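import Summits.AtomisticToContinuum.Crystallization.Theorems.AtomicLawChargesCrystal.Negative.LatticeLaw
import Summits.AtomisticToContinuum.Crystallization.Theorems.AtomicLawChargesCrystal.Negative.FalseWithoutRelDense

/-!
# Negative knowledge for crux `AtomicLawChargesCrystal` (stmt-AtomisticToContinuum-15778):
# point-stationarity (the Mecke identity) is LOAD-BEARING

`IsometryAtoms.AtomicLawChargesCrystal` turns an atom modulo isometry of a POINT-STATIONARY,
a.s. hard-core, a.s. relatively dense probability law into a charged periodic configuration.
Deleting the single hypothesis `IsPointStationaryLaw P` (everything else verbatim) makes the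
statement FALSE, and the witness is a genuine Delone atom: the deterministic law `δ_{count|Y₀}` of
the INTERSTITIAL CRYSTAL `Y₀ = ℤ³ ∪ {c}`, `c = (½, ½, ½)`, rooted at `0`.

* `δ_{count|Y₀}` is a probability law, a.s. `½`-hard-core, a.s. relatively dense (`R₀ = 1`), and an
  atom (mass `1`) at `Y = Y₀` — four of the five hypotheses of the crux;
* it charges NO window of ANY periodic `Q`: if `g ≠ 0` is a period of `Q`, the two-way matching at
  radius `R = ‖g‖ + 2` and tolerance `ε = min (1/8) (‖g‖/4)` through `(A, q)` forces a particle of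
  `Y₀` near `A g`; if that particle is `c` then `-A g ≈ -c`, an EMPTY interstitial site (every point
  of `Y₀` has first coordinate at distance `≥ ½` from `-½`); if it is a lattice vector `n ≠ 0` then,
  matching the `Q`-point `s_c + g` next to the `Q`-point `s_c` that covers `c`, a particle of `Y₀`
  sits within `3ε < ½` of the empty site `c + n`; `n = 0` contradicts `‖A g‖ = ‖g‖ ≥ 4ε`.  The event
  is contained in the measurable null set `{μ | μ ≠ count|Y₀}` (`{count|Y₀}` is Giry-measurable,
  `LatticeLaw.measurableSet_setOf_eq_count_restrict`).

So any proof of the crux must use the Mecke identity itself, not only the shape of its carrier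
(the witness is NOT point-stationary: re-rooting at `c` or at `n ≠ 0` changes the configuration —
`InterstitialNotPointStationary.not_isPointStationaryLaw_dirac_interstitial`, companion file).  Companion of `Negative.FalseWithoutRelDense`
(relative density) and `Negative.LatticeLaw` (non-vacuity).  Refuter crux-disprover, cycle 1;
supports item stmt-AtomisticToContinuum-15778.
-/

noncomputable section

open MeasureTheory
open scoped ENNReal

namespace Summit.AtomisticToContinuum.Crystallization.Theorems.AtomicLawChargesCrystal.Negative.FalseWithoutPointStationarity

open Literature.Probability.Process
open Literature.MathematicalPhysics.StatisticalMechanics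
open LatticeLaw

local notation "E3" => EuclideanSpace ℝ (Fin 3)

/-! ### The interstitial crystal `ℤ³ ∪ {c}` -/

/-- The body centre `c = (½, ½, ½)`. -/
def ctr : E3 := WithLp.toLp 2 fun _ => (1 / 2 : ℝ)

/-- Coordinates of `c`. -/
@[simp] theorem ctr_apply (i : Fin 3) : ctr i = 1 / 2 := rfl

/-- The interstitial crystal `Y₀ = ℤ³ ∪ {c}`. -/
def interSet : Set E3 := zCube ∪ {ctr}

/-- `Y₀` is countable. -/
theorem interSet_countable : interSet.Countable :=
  zCube_countable.union (Set.countable_singleton ctr)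

/-- The root `0` is a point of `Y₀`. -/
theorem zero_mem_interSet : (0 : E3) ∈ interSet := Or.inl zero_mem_zCube

/-- `ℤ³ ⊆ Y₀`. -/
theorem zCube_subset_interSet : zCube ⊆ interSet := Set.subset_union_left

/-- `c ∈ Y₀`. -/
theorem ctr_mem_interSet : ctr ∈ interSet := Or.inr rfl

/-- An integer is at distance `≥ ½` from every half-integer. -/
theorem half_le_abs_int_sub_half (j k : ℤ) : (1 / 2 : ℝ) ≤ |(j : ℝ) - ((k : ℝ) + 1 / 2)| := by
  rcases le_or_gt (k + 1) j with h | h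
  · have h' : (k : ℝ) + 1 ≤ j := by exact_mod_cast h
    rw [abs_of_nonneg (by linarith)]
    linarith
  · have h' : (j : ℝ) ≤ k := by exact_mod_cast (Int.lt_add_one_iff.1 h)
    rw [abs_of_neg (by linarith)]
    linarith

/-- Lattice points are at distance `≥ ½` from every point whose first coordinate is a half-integer
(the empty interstitial sites `-c`, `c + n`). -/
theorem half_le_dist_of_mem_zCube {m p : E3} (hm : m ∈ zCube) (hp : ∃ k : ℤ, p 0 = (k : ℝ) + 1 / 2) :
    (1 / 2 : ℝ) ≤ dist m p := by
  obtain ⟨n, rfl⟩ := hm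
  obtain ⟨k, hk⟩ := hp
  calc (1 / 2 : ℝ) ≤ |(n 0 : ℝ) - ((k : ℝ) + 1 / 2)| := half_le_abs_int_sub_half (n 0) k
    _ = |zVec n 0 - p 0| := by rw [zVec_apply, hk]
    _ ≤ dist (zVec n) p := by
        rw [dist_eq_norm, ← Real.norm_eq_abs]; exact PiLp.norm_apply_le (zVec n - p) 0

/-- `Y₀` is `½`-separated. -/
theorem interSet_separated : ∀ x ∈ interSet, ∀ y ∈ interSet, x ≠ y → (1 / 2 : ℝ) ≤ dist x y := by
  intro x hx y hy hxy
  rcases hx with hx | hx <;> rcases hy with hy | hy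
  · exact (by norm_num : (1 / 2 : ℝ) ≤ 1).trans (zCube_separated x hx y hy hxy)
  · rw [Set.mem_singleton_iff] at hy
    subst hy
    exact half_le_dist_of_mem_zCube hx ⟨0, by simp⟩
  · rw [Set.mem_singleton_iff] at hx
    subst hx
    rw [dist_comm]
    exact half_le_dist_of_mem_zCube hy ⟨0, by simp⟩
  · rw [Set.mem_singleton_iff] at hx hy
    exact absurd (hx.trans hy.symm) hxy

/-- Every point of `Y₀` is at distance `≥ ½` from the empty site `-c`. -/
theorem half_le_dist_neg_ctr {x : E3} (hx : x ∈ interSet) : (1 / 2 : ℝ) ≤ dist x (-ctr) := by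
  rcases hx with hx | hx
  · exact half_le_dist_of_mem_zCube hx ⟨-1, by simp; norm_num⟩
  · rw [Set.mem_singleton_iff] at hx
    subst hx
    calc (1 / 2 : ℝ) ≤ |ctr 0 - (-ctr) 0| := by simp; norm_num
      _ ≤ dist ctr (-ctr) := by
          rw [dist_eq_norm, ← Real.norm_eq_abs]; exact PiLp.norm_apply_le (ctr - -ctr) 0

/-- Every point of `Y₀` is at distance `≥ ½` from the empty site `c + n`, `n ∈ ℤ³ ∖ {0}`. -/
theorem half_le_dist_ctr_add {x n : E3} (hx : x ∈ interSet) (hn : n ∈ zCube) (hn0 : n ≠ 0) :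
    (1 / 2 : ℝ) ≤ dist x (ctr + n) := by
  rcases hx with hx | hx
  · obtain ⟨k, rfl⟩ := hn
    exact half_le_dist_of_mem_zCube hx ⟨k 0, by simp [add_comm]⟩
  · rw [Set.mem_singleton_iff] at hx
    subst hx
    rw [dist_eq_norm, sub_add_cancel_left, norm_neg]
    exact (by norm_num : (1 / 2 : ℝ) ≤ 1).trans (one_le_norm_of_mem_zCube hn hn0)

/-! ### The deterministic law `δ_{count|Y₀}` -/

/-- The rooted interstitial configuration `count|Y₀`. -/
def interConfig : Measure E3 := (Measure.count : Measure E3).restrict interSet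

/-- The points of `count|Y₀` are exactly `Y₀`. -/
theorem interConfig_singleton_ne_zero_iff (y : E3) : interConfig {y} ≠ 0 ↔ y ∈ interSet :=
  count_restrict_singleton_ne_zero_iff interSet y

/-- Under a deterministic law `δ_{count|D}`, `D` countable, almost every configuration IS
`count|D` (the singleton `{count|D}` is Giry-measurable, `measurableSet_setOf_eq_count_restrict`).
[folklore] -/
theorem ae_eq_dirac_countRestrict {D : Set E3} (hD : D.Countable) :
    ∀ᵐ μ ∂(Measure.dirac ((Measure.count : Measure E3).restrict D) : Measure (Measure E3)),
      μ = (Measure.count : Measure E3).restrict D := by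
  rw [ae_iff]
  have h : {μ : Measure E3 | ¬μ = (Measure.count : Measure E3).restrict D} =
      {μ : Measure E3 | μ = (Measure.count : Measure E3).restrict D}ᶜ := rfl
  rw [h, Measure.dirac_apply' _ (measurableSet_setOf_eq_count_restrict hD).compl]
  simp

/-- A set of configurations missing `count|D` (`D` countable) is `δ_{count|D}`-null, measurable or
not (through the measurable singleton `{count|D}`). [folklore] -/
theorem dirac_countRestrict_null {D : Set E3} (hD : D.Countable) {M : Set (Measure E3)}
    (hM : (Measure.count : Measure E3).restrict D ∉ M) :
    (Measure.dirac ((Measure.count : Measure E3).restrict D) : Measure (Measure E3)) M = 0 := by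
  refine measure_mono_null (t := {μ : Measure E3 | μ = (Measure.count : Measure E3).restrict D}ᶜ)
    (fun μ hμ h => hM (h ▸ hμ)) ?_
  rw [Measure.dirac_apply' _ (measurableSet_setOf_eq_count_restrict hD).compl]
  simp


/-- `count|Y₀` is a rooted `½`-hard-core configuration. -/
theorem isRootedHardCore_interConfig : IsRootedHardCore (1 / 2) interConfig :=
  ⟨interSet, zero_mem_interSet, interSet_separated, rfl⟩

/-- `count|Y₀` is relatively dense (`R₀ = 1`, already through its sublattice `ℤ³`). -/
theorem relDense_interConfig : ∃ R₀ : ℝ, ∀ z : E3, ∃ y : E3, interConfig {y} ≠ 0 ∧ dist z y ≤ R₀ := by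
  refine ⟨1, fun z => ?_⟩
  obtain ⟨y, hy, hd⟩ := zCube_relDense z
  exact ⟨y, (interConfig_singleton_ne_zero_iff y).2 (zCube_subset_interSet hy), hd⟩

/-- `count|Y₀` lies in the rooted isometry class of `Y₀` (`A = 1`, `q = 0`). -/
theorem interConfig_mem_isometryClass :
    interConfig ∈ {μ : Measure E3 | ∃ A : E3 →ₗᵢ[ℝ] E3, ∃ q ∈ interSet,
      μ = (Measure.count : Measure E3).restrict ((fun s => A (s - q)) '' interSet)} := by
  refine ⟨LinearIsometry.id, 0, zero_mem_interSet, ?_⟩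
  unfold interConfig
  congr 1
  ext v
  simp

/-! ### No periodic configuration matches `Y₀` at all scales -/

/-- **The interstitial crystal matches no periodic window**: for every `Q : PeriodicConfiguration 3`
there are `R, ε > 0` such that `count|Y₀` is NOT in the two-way `(R, ε)`-matching event of `Q`. -/
theorem interConfig_not_mem_window (Q : PeriodicConfiguration 3) :
    ∃ R ε : ℝ, 0 < R ∧ 0 < ε ∧ interConfig ∉ {μ : Measure E3 | ∃ A : E3 →ₗᵢ[ℝ] E3, ∃ q ∈ Q.points,
      (∀ s ∈ Q.points, dist s q ≤ R → ∃ y : E3, μ {y} ≠ 0 ∧ dist y (A (s - q)) ≤ ε) ∧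
      (∀ y : E3, μ {y} ≠ 0 → ‖y‖ ≤ R → ∃ s ∈ Q.points, dist y (A (s - q)) ≤ ε)} := by
  obtain ⟨g, hg, hg0⟩ := FalseWithoutRelDense.exists_ne_zero_mem_lattice Q
  have hgpos : 0 < ‖g‖ := norm_pos_iff.2 hg0
  refine ⟨‖g‖ + 2, min (1 / 8) (‖g‖ / 4), by positivity, by positivity, ?_⟩
  set ε : ℝ := min (1 / 8) (‖g‖ / 4) with hεdef
  have hε8 : ε ≤ 1 / 8 := min_le_left _ _
  have hεg : ε ≤ ‖g‖ / 4 := min_le_right _ _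
  have hεpos : 0 < ε := by positivity
  rintro ⟨A, q, hq, h1, h2⟩
  -- norm of `c`
  have hctr : ‖ctr‖ ≤ 1 := by
    rw [EuclideanSpace.norm_eq]
    have hs : ∑ i : Fin 3, ‖ctr i‖ ^ 2 = 3 / 4 := by
      simp
      norm_num
    rw [hs]
    rw [Real.sqrt_le_left (by norm_num : (0:ℝ) ≤ 1)]
    norm_num
  -- Step 1: the `Q`-points `q ± g` force particles near `± A g`.
  obtain ⟨y₁, hy₁, hd₁⟩ := h1 (q + g) (Q.add_mem_points hq hg)
    (by rw [dist_eq_norm, add_sub_cancel_left]; linarith)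
  rw [add_sub_cancel_left] at hd₁
  obtain ⟨y₂, hy₂, hd₂⟩ := h1 (q + -g) (Q.add_mem_points hq (Q.lattice.neg_mem hg))
    (by rw [dist_eq_norm, add_sub_cancel_left, norm_neg]; linarith)
  rw [add_sub_cancel_left, map_neg] at hd₂
  rw [interConfig_singleton_ne_zero_iff] at hy₁ hy₂
  -- Step 2: the particle `c` is covered by some `Q`-point `s_c`, and `s_c + g` forces a particle
  -- near `c + A g`.
  obtain ⟨sc, hsc, hdc⟩ := h2 ctr ((interConfig_singleton_ne_zero_iff _).2 ctr_mem_interSet)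
    (hctr.trans (by linarith))
  have hsc_norm : ‖A (sc - q)‖ ≤ 1 + ε := by
    have := norm_le_of_mem_closedBall (Metric.mem_closedBall.2 (dist_comm ctr _ ▸ hdc))
    -- ‖A(sc-q)‖ ≤ ‖ctr‖ + dist
    calc ‖A (sc - q)‖ ≤ ‖ctr‖ + dist (A (sc - q)) ctr := by
          have := norm_le_norm_add_norm_sub' (A (sc - q)) ctr
          rw [dist_eq_norm]; linarith [norm_sub_rev (A (sc - q)) ctr]
      _ ≤ 1 + ε := by rw [dist_comm]; linarith
  obtain ⟨y₃, hy₃, hd₃⟩ := h1 (sc + g) (Q.add_mem_points hsc hg) (by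
    calc dist (sc + g) q = ‖(sc - q) + g‖ := by rw [dist_eq_norm]; congr 1; abel
      _ ≤ ‖sc - q‖ + ‖g‖ := norm_add_le _ _
      _ = ‖A (sc - q)‖ + ‖g‖ := by rw [A.norm_map]
      _ ≤ ‖g‖ + 2 := by linarith)
  rw [interConfig_singleton_ne_zero_iff] at hy₃
  have hA3 : A (sc + g - q) = A (sc - q) + A g := by
    rw [← map_add]; congr 1; abel
  rw [hA3] at hd₃
  have hd₃' : dist y₃ (ctr + A g) ≤ 2 * ε := by
    calc dist y₃ (ctr + A g) ≤ dist y₃ (A (sc - q) + A g) + dist (A (sc - q) + A g) (ctr + A g) :=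
          dist_triangle _ _ _
      _ ≤ ε + ε := by
          gcongr
          rw [dist_eq_norm, add_sub_add_right_eq_sub, ← dist_eq_norm, dist_comm]
          exact hdc
      _ = 2 * ε := by ring
  -- Step 3: case analysis on the particle near `A g`.
  rcases hy₁ with hy₁ | hy₁
  · -- `y₁ = n ∈ ℤ³`
    by_cases hn0 : y₁ = 0
    · subst hn0
      rw [dist_comm, dist_zero_right, A.norm_map] at hd₁
      linarith
    · have hfar := half_le_dist_ctr_add hy₃ hy₁ hn0
      have hnear : dist y₃ (ctr + y₁) ≤ 3 * ε := by
        calc dist y₃ (ctr + y₁) ≤ dist y₃ (ctr + A g) + dist (ctr + A g) (ctr + y₁) := dist_triangle _ _ _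
          _ ≤ 2 * ε + ε := by
              gcongr
              rw [dist_eq_norm, add_sub_add_left_eq_sub, ← dist_eq_norm, dist_comm]
              exact hd₁
          _ = 3 * ε := by ring
      linarith
  · -- `y₁ = c`: then `-A g ≈ -c`, an empty site, but `y₂ ≈ -A g`.
    rw [Set.mem_singleton_iff] at hy₁
    subst hy₁
    have hfar := half_le_dist_neg_ctr hy₂
    have hnear : dist y₂ (-ctr) ≤ 2 * ε := by
      calc dist y₂ (-ctr) ≤ dist y₂ (-A g) + dist (-A g) (-ctr) := dist_triangle _ _ _
        _ ≤ ε + ε := by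
            gcongr
            rw [dist_neg_neg, dist_comm]
            exact hd₁
        _ = 2 * ε := by ring
    linarith

/-! ### The negative lemma -/

/-- **Point-stationarity is load-bearing in `AtomicLawChargesCrystal`**: the crux with its
hypothesis `IsPointStationaryLaw P` deleted (everything else verbatim) is false, witnessed by the
deterministic interstitial crystal law `δ_{count|(ℤ³ ∪ {(½,½,½)})}` — a probability law, a.s.
`½`-hard-core, a.s. relatively dense (`R₀ = 1`), an atom at `Y = ℤ³ ∪ {c}`, charging no window
`(‖g‖ + 2, min (1/8) (‖g‖/4))` of any periodic `Q` with period `g ≠ 0`. [folklore] -/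
theorem atomicLawChargesCrystal_false_without_pointStationarity :
    ¬ (∀ δ : ℝ, 0 < δ → ∀ P : Measure (Measure E3), IsProbabilityMeasure P →
        (∀ᵐ μ ∂P, IsRootedHardCore δ μ) →
        (∀ᵐ μ ∂P, ∃ R₀ : ℝ, ∀ z : E3, ∃ y : E3, μ {y} ≠ 0 ∧ dist z y ≤ R₀) →
        (∃ Y : Set E3, 0 < P {μ | ∃ A : E3 →ₗᵢ[ℝ] E3, ∃ q ∈ Y,
            μ = (Measure.count : Measure E3).restrict ((fun s => A (s - q)) '' Y)}) →
        ∃ Q : PeriodicConfiguration 3, ∀ R ε : ℝ, 0 < R → 0 < ε →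
          0 < P {μ | ∃ A : E3 →ₗᵢ[ℝ] E3, ∃ q ∈ Q.points,
            (∀ s ∈ Q.points, dist s q ≤ R → ∃ y : E3, μ {y} ≠ 0 ∧ dist y (A (s - q)) ≤ ε) ∧
            (∀ y : E3, μ {y} ≠ 0 → ‖y‖ ≤ R → ∃ s ∈ Q.points, dist y (A (s - q)) ≤ ε)}) := by
  intro h
  have hae : ∀ᵐ μ ∂(Measure.dirac interConfig : Measure (Measure E3)), μ = interConfig :=
    ae_eq_dirac_countRestrict interSet_countable
  have hHC : ∀ᵐ μ ∂(Measure.dirac interConfig : Measure (Measure E3)), IsRootedHardCore (1 / 2) μ :=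
    hae.mono fun μ hμ => hμ ▸ isRootedHardCore_interConfig
  have hRD : ∀ᵐ μ ∂(Measure.dirac interConfig : Measure (Measure E3)),
      ∃ R₀ : ℝ, ∀ z : E3, ∃ y : E3, μ {y} ≠ 0 ∧ dist z y ≤ R₀ :=
    hae.mono fun μ hμ => hμ ▸ relDense_interConfig
  have hAtom : ∃ Y : Set E3, 0 < (Measure.dirac interConfig : Measure (Measure E3))
      {μ | ∃ A : E3 →ₗᵢ[ℝ] E3, ∃ q ∈ Y,
        μ = (Measure.count : Measure E3).restrict ((fun s => A (s - q)) '' Y)} := by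
    refine ⟨interSet, ?_⟩
    have hind : Set.indicator {μ : Measure E3 | ∃ A : E3 →ₗᵢ[ℝ] E3, ∃ q ∈ interSet,
        μ = (Measure.count : Measure E3).restrict ((fun s => A (s - q)) '' interSet)}
        (1 : Measure E3 → ℝ≥0∞) interConfig = 1 := by
      rw [Set.indicator_of_mem interConfig_mem_isometryClass, Pi.one_apply]
    calc (0 : ℝ≥0∞) < 1 := one_pos
      _ = _ := hind.symm
      _ ≤ _ := Measure.le_dirac_apply
  obtain ⟨Q, hQ⟩ := h (1 / 2) (by norm_num) _ inferInstance hHC hRD hAtom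
  obtain ⟨R, ε, hR, hε, hnot⟩ := interConfig_not_mem_window Q
  exact absurd (dirac_countRestrict_null interSet_countable hnot) (hQ R ε hR hε).ne'

end Summit.AtomisticToContinuum.Crystallization.Theorems.AtomicLawChargesCrystal.Negative.FalseWithoutPointStationarity
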